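import Mathlib
import Summits.Ventures.PercRepro2.Defs
import Summits.Ventures.PercRepro2.Graph
import Summits.Ventures.PercRepro2.Events
import Summits.Ventures.PercRepro2.CycleDefs
import Summits.Ventures.PercRepro2.CycleTerm

/-!
# The antipodal term of a cycle with a SET of hit vertices (blind cell PercRepro2, mine-a g47)

The three-event inequality (T_A) of MINE-A.md §95.10 has `Q = {A ⊆ C_r}` for a finite set `A` of
vertices (the principal up-set; `A = {h}` is (T_h)).  On a cycle `A ⊆ C_0 = arc Z` means that every
vertex of `A` lies in the arc of the closed edges, i.e. no closed edge straddles a vertex of `A`.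
This file generalises `CycleTerm` from one hit vertex `h` to the hit predicate `hitA A S = ∀ a ∈ A, a ∈ S`:
the term `wtA`, its values in `{−1, 0, 1}`, the facts on negative colourings (exactly one extreme
position of `D` is red, the arc of `D` lies in neither family, everything lies in both), and the
one-sided analyses `neg_min_specA` / `neg_max_specA` with a *witness cut* `c ∈ A` strictly inside
the hull of `D`: red at `min D` forces the last red position `l < c`, red at `max D` forces the
first red position `c ≤ f`, and the union arc `V ∖ (f, l]` lies in both families.  The counting
core `CycleCoreA` and the assembly `TCycleA` follow `CycleCore` / `CycleBase` / `TCycle` with the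
hit predicate inherited along `arc τ ⊆ arc (phi τ)`.  No instance, no notation.
-/

namespace Summit.Ventures.PercRepro2

namespace TCycle

open Finset

variable {n : ℕ}

/-- The hit predicate of a set of vertices: every vertex of `A` lies in the set `S`. -/
def hitA (A : Finset (Fin (n + 1))) (S : Set (Fin (n + 1))) : Prop := ∀ a ∈ A, a ∈ S

/-- `hitA` is monotone in the set. -/
lemma hitA_mono {A : Finset (Fin (n + 1))} {S S' : Set (Fin (n + 1))} (h : S ⊆ S')
    (hS : hitA A S) : hitA A S' := fun a ha => h (hS a ha)

/-- `hitA` of everything. -/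
lemma hitA_univ (A : Finset (Fin (n + 1))) : hitA A Set.univ := fun _ _ => Set.mem_univ _

open Classical in
/-- The term of the antipodal 2-colouring sum at the red set `τ ⊆ D` with the hit set `A`. -/
noncomputable def wtA (D A : Finset (Fin (n + 1))) (𝓤 𝓥 : Set (Set (Fin (n + 1))))
    (τ : Finset (Fin (n + 1))) : ℤ :=
  (if hitA A (arc τ) then 1 else 0)
    * ((if arc τ ∈ 𝓤 then 1 else 0) - (if arc (D \ τ) ∈ 𝓤 then 1 else 0))
    * ((if arc τ ∈ 𝓥 then 1 else 0) - (if arc (D \ τ) ∈ 𝓥 then 1 else 0))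

/-- The term lies in `{−1, 0, 1}`. -/
lemma wtA_mem (D A : Finset (Fin (n + 1))) (𝓤 𝓥 : Set (Set (Fin (n + 1))))
    (τ : Finset (Fin (n + 1))) :
    wtA D A 𝓤 𝓥 τ = -1 ∨ wtA D A 𝓤 𝓥 τ = 0 ∨ wtA D A 𝓤 𝓥 τ = 1 := by
  unfold wtA
  split_ifs <;> norm_num

/-- A term equal to `−1`: the hit predicate holds on the red arc and the two arcs are split by `𝓤`
and by `𝓥` in opposite ways. -/
lemma of_wtA_eq_neg_one {D A : Finset (Fin (n + 1))} {𝓤 𝓥 : Set (Set (Fin (n + 1)))}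
    {τ : Finset (Fin (n + 1))} (hw : wtA D A 𝓤 𝓥 τ = -1) :
    hitA A (arc τ) ∧
      ((arc τ ∈ 𝓤 ∧ arc (D \ τ) ∉ 𝓤 ∧ arc τ ∉ 𝓥 ∧ arc (D \ τ) ∈ 𝓥) ∨
        (arc τ ∉ 𝓤 ∧ arc (D \ τ) ∈ 𝓤 ∧ arc τ ∈ 𝓥 ∧ arc (D \ τ) ∉ 𝓥)) := by
  unfold wtA at hw
  by_cases hh : hitA A (arc τ) <;> by_cases a : arc τ ∈ 𝓤 <;> by_cases b : arc (D \ τ) ∈ 𝓤 <;>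
    by_cases c : arc τ ∈ 𝓥 <;> by_cases d : arc (D \ τ) ∈ 𝓥 <;>
    simp only [hh, a, b, c, d, if_true, if_false] at hw <;>
    first
    | exact ⟨hh, Or.inl ⟨a, b, c, d⟩⟩
    | exact ⟨hh, Or.inr ⟨a, b, c, d⟩⟩
    | norm_num at hw

/-- A term equal to `1` from the four memberships. -/
lemma wtA_eq_one_of {D A : Finset (Fin (n + 1))} {𝓤 𝓥 : Set (Set (Fin (n + 1)))}
    {τ : Finset (Fin (n + 1))} (hh : hitA A (arc τ)) (hU : arc τ ∈ 𝓤) (hV : arc τ ∈ 𝓥)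
    (hU' : arc (D \ τ) ∉ 𝓤) (hV' : arc (D \ τ) ∉ 𝓥) : wtA D A 𝓤 𝓥 τ = 1 := by
  unfold wtA
  simp [hh, hU, hV, hU', hV']

/-- When the red arc is contained in the blue arc the term is nonnegative. -/
lemma wtA_nonneg_of_subset {D A : Finset (Fin (n + 1))} {𝓤 𝓥 : Set (Set (Fin (n + 1)))}
    (hU : IsUpperSet 𝓤) (hV : IsUpperSet 𝓥) {τ : Finset (Fin (n + 1))}
    (hsub : arc τ ⊆ arc (D \ τ)) : 0 ≤ wtA D A 𝓤 𝓥 τ := by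
  unfold wtA
  by_cases hh : hitA A (arc τ) <;> by_cases a : arc τ ∈ 𝓤 <;> by_cases b : arc (D \ τ) ∈ 𝓤 <;>
    by_cases c : arc τ ∈ 𝓥 <;> by_cases d : arc (D \ τ) ∈ 𝓥 <;>
    simp only [hh, a, b, c, d, if_true, if_false] <;>
    first | exact absurd (hU hsub a) b | exact absurd (hV hsub c) d | norm_num

/-- When the blue arc is contained in the red arc the term is nonnegative. -/
lemma wtA_nonneg_of_superset {D A : Finset (Fin (n + 1))} {𝓤 𝓥 : Set (Set (Fin (n + 1)))}
    (hU : IsUpperSet 𝓤) (hV : IsUpperSet 𝓥) {τ : Finset (Fin (n + 1))}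
    (hsub : arc (D \ τ) ⊆ arc τ) : 0 ≤ wtA D A 𝓤 𝓥 τ := by
  unfold wtA
  by_cases hh : hitA A (arc τ) <;> by_cases a : arc τ ∈ 𝓤 <;> by_cases b : arc (D \ τ) ∈ 𝓤 <;>
    by_cases c : arc τ ∈ 𝓥 <;> by_cases d : arc (D \ τ) ∈ 𝓥 <;>
    simp only [hh, a, b, c, d, if_true, if_false] <;>
    first | exact absurd (hU hsub b) a | exact absurd (hV hsub d) c | norm_num

/-! ## Negative colourings -/

section Negatives

variable {D A : Finset (Fin (n + 1))} (hD : D.Nonempty) {𝓤 𝓥 : Set (Set (Fin (n + 1)))}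

/-- A negative colouring does not contain both extreme positions. -/
lemma not_both_of_negA (hU : IsUpperSet 𝓤) (hV : IsUpperSet 𝓥) {τ : Finset (Fin (n + 1))}
    (hτ : τ ⊆ D) (hw : wtA D A 𝓤 𝓥 τ = -1) : ¬ (D.min' hD ∈ τ ∧ D.max' hD ∈ τ) := by
  rintro ⟨h0, h1⟩
  have := wtA_nonneg_of_subset (D := D) (A := A) hU hV
    (τ := τ) (by rw [arc_of_both D hD hτ h0 h1]; exact arc_D_subset D sdiff_subset)
  omega

/-- A negative colouring contains at least one extreme position. -/
lemma not_neither_of_negA (hU : IsUpperSet 𝓤) (hV : IsUpperSet 𝓥) {τ : Finset (Fin (n + 1))}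
    (hτ : τ ⊆ D) (hw : wtA D A 𝓤 𝓥 τ = -1) : ¬ (D.min' hD ∉ τ ∧ D.max' hD ∉ τ) := by
  rintro ⟨h0, h1⟩
  have := wtA_nonneg_of_superset (D := D) (A := A) hU hV
    (τ := τ) (by rw [arc_sdiff_of_neither D hD h0 h1]; exact arc_D_subset D hτ)
  omega

/-- For a negative colouring the arc of `D` lies in neither family and everything lies in both. -/
lemma arc_D_notMem_of_negA (hU : IsUpperSet 𝓤) (hV : IsUpperSet 𝓥) {τ : Finset (Fin (n + 1))}
    (hτ : τ ⊆ D) (hw : wtA D A 𝓤 𝓥 τ = -1) :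
    arc D ∉ 𝓤 ∧ arc D ∉ 𝓥 ∧ (Set.univ : Set (Fin (n + 1))) ∈ 𝓤 ∧
      (Set.univ : Set (Fin (n + 1))) ∈ 𝓥 := by
  obtain ⟨-, hc⟩ := of_wtA_eq_neg_one hw
  have hsub1 : arc D ⊆ arc τ := arc_D_subset D hτ
  have hsub2 : arc D ⊆ arc (D \ τ) := arc_D_subset D sdiff_subset
  have hu1 : arc τ ⊆ Set.univ := Set.subset_univ _
  have hu2 : arc (D \ τ) ⊆ Set.univ := Set.subset_univ _
  rcases hc with ⟨hU1, hU2, hV1, hV2⟩ | ⟨hU1, hU2, hV1, hV2⟩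
  · exact ⟨fun hm => hU2 (hU hsub2 hm), fun hm => hV1 (hV hsub1 hm), hU hu1 hU1, hV hu2 hV2⟩
  · exact ⟨fun hm => hU1 (hU hsub1 hm), fun hm => hV2 (hV hsub2 hm), hU hu2 hU2, hV hu1 hV1⟩

/-- **Red at `min D`, blue at `max D`, negative term, witness cut `c ∈ A` inside the hull**: with
`l` the last red and `f` the first blue position, `l < c`, `min D < l < max D`, `min D < f`, and
the union arc `V ∖ (f, l]` lies in both families. -/
lemma neg_min_specA (hU : IsUpperSet 𝓤) (hV : IsUpperSet 𝓥) {c : Fin (n + 1)} (hcA : c ∈ A)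
    (hc0 : D.min' hD < c) {τ : Finset (Fin (n + 1))} (hτ : τ ⊆ D) (h0 : D.min' hD ∈ τ)
    (h1 : D.max' hD ∉ τ) (hw : wtA D A 𝓤 𝓥 τ = -1) :
    τ.max' ⟨_, h0⟩ < c ∧ D.min' hD < τ.max' ⟨_, h0⟩ ∧ τ.max' ⟨_, h0⟩ < D.max' hD ∧
      D.min' hD < (D \ τ).min' ⟨_, mem_sdiff.2 ⟨D.max'_mem hD, h1⟩⟩ ∧
      {v | v ≤ (D \ τ).min' ⟨_, mem_sdiff.2 ⟨D.max'_mem hD, h1⟩⟩ ∨ τ.max' ⟨_, h0⟩ < v} ∈ 𝓤 ∧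
      {v | v ≤ (D \ τ).min' ⟨_, mem_sdiff.2 ⟨D.max'_mem hD, h1⟩⟩ ∨ τ.max' ⟨_, h0⟩ < v} ∈ 𝓥 := by
  set l := τ.max' ⟨_, h0⟩ with hl
  set f := (D \ τ).min' ⟨_, mem_sdiff.2 ⟨D.max'_mem hD, h1⟩⟩ with hf
  have hlτ : l ∈ τ := τ.max'_mem _
  have hfD : f ∈ D \ τ := (D \ τ).min'_mem _
  have hfτ : f ∉ τ := (mem_sdiff.1 hfD).2
  have harc : arc τ = {v | v ≤ D.min' hD ∨ l < v} := arc_of_min_mem D hD hτ h0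
  have harc' : arc (D \ τ) = {v | v ≤ f ∨ D.max' hD < v} := arc_sdiff_of_max_notMem D hD h1
  obtain ⟨hh, hc⟩ := of_wtA_eq_neg_one hw
  have hcarc : c ∈ arc τ := hh c hcA
  have hlh : l < c := by
    rw [harc] at hcarc
    rcases hcarc with hcarc | hcarc
    · exact absurd hcarc (not_le.2 hc0)
    · exact hcarc
  have h0l : D.min' hD < l := by
    rcases lt_or_eq_of_le (D.min'_le l (hτ hlτ)) with hlt | heq
    · exact hlt
    · exfalso
      have hsub : arc (D \ τ) ⊆ arc τ := by
        rw [harc, ← heq]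
        intro v _
        by_cases hv : v ≤ D.min' hD
        · exact Or.inl hv
        · exact Or.inr (lt_of_not_ge hv)
      have := wtA_nonneg_of_superset (D := D) (A := A) hU hV hsub
      omega
  have hl1 : l < D.max' hD :=
    lt_of_le_of_ne (D.le_max' l (hτ hlτ)) fun heq => h1 (heq ▸ hlτ)
  have h0f : D.min' hD < f :=
    lt_of_le_of_ne (D.min'_le f (mem_sdiff.1 hfD).1) fun heq => hfτ (heq ▸ h0)
  have hW1 : arc τ ⊆ {v | v ≤ f ∨ l < v} := by
    rw [harc]
    rintro v (hv | hv)
    · exact Or.inl (le_trans hv h0f.le)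
    · exact Or.inr hv
  have hW2 : arc (D \ τ) ⊆ {v | v ≤ f ∨ l < v} := by
    rw [harc']
    rintro v (hv | hv)
    · exact Or.inl hv
    · exact Or.inr (lt_trans hl1 hv)
  refine ⟨hlh, h0l, hl1, h0f, ?_, ?_⟩
  · rcases hc with ⟨hU1, -, -, -⟩ | ⟨-, hU2, -, -⟩
    · exact hU hW1 hU1
    · exact hU hW2 hU2
  · rcases hc with ⟨-, -, -, hV2⟩ | ⟨-, -, hV1, -⟩
    · exact hV hW2 hV2
    · exact hV hW1 hV1

/-- **Blue at `min D`, red at `max D`, negative term, witness cut `c ∈ A` inside the hull**: with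
`f` the first red and `l` the last blue position, `c ≤ f`, `min D < f < max D`, `l < max D`, and
the union arc `V ∖ (f, l]` lies in both families. -/
lemma neg_max_specA (hU : IsUpperSet 𝓤) (hV : IsUpperSet 𝓥) {c : Fin (n + 1)} (hcA : c ∈ A)
    (hc1 : c ≤ D.max' hD) {τ : Finset (Fin (n + 1))} (hτ : τ ⊆ D) (h0 : D.min' hD ∉ τ)
    (h1 : D.max' hD ∈ τ) (hw : wtA D A 𝓤 𝓥 τ = -1) :
    c ≤ τ.min' ⟨_, h1⟩ ∧ D.min' hD < τ.min' ⟨_, h1⟩ ∧ τ.min' ⟨_, h1⟩ < D.max' hD ∧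
      (D \ τ).max' ⟨_, mem_sdiff.2 ⟨D.min'_mem hD, h0⟩⟩ < D.max' hD ∧
      {v | v ≤ τ.min' ⟨_, h1⟩ ∨ (D \ τ).max' ⟨_, mem_sdiff.2 ⟨D.min'_mem hD, h0⟩⟩ < v} ∈ 𝓤 ∧
      {v | v ≤ τ.min' ⟨_, h1⟩ ∨ (D \ τ).max' ⟨_, mem_sdiff.2 ⟨D.min'_mem hD, h0⟩⟩ < v} ∈ 𝓥 := by
  set f := τ.min' ⟨_, h1⟩ with hf
  set l := (D \ τ).max' ⟨_, mem_sdiff.2 ⟨D.min'_mem hD, h0⟩⟩ with hl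
  have hfτ : f ∈ τ := τ.min'_mem _
  have hlD : l ∈ D \ τ := (D \ τ).max'_mem _
  have hlτ : l ∉ τ := (mem_sdiff.1 hlD).2
  have harc : arc τ = {v | v ≤ f ∨ D.max' hD < v} := arc_of_max_mem D hD hτ h1
  have harc' : arc (D \ τ) = {v | v ≤ D.min' hD ∨ l < v} := arc_sdiff_of_min_notMem D hD h0
  obtain ⟨hh, hc⟩ := of_wtA_eq_neg_one hw
  have hcarc : c ∈ arc τ := hh c hcA
  have hhf : c ≤ f := by
    rw [harc] at hcarc
    rcases hcarc with hcarc | hcarc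
    · exact hcarc
    · exact absurd hcarc (not_lt.2 hc1)
  have hf1 : f < D.max' hD := by
    rcases lt_or_eq_of_le (D.le_max' f (hτ hfτ)) with hlt | heq
    · exact hlt
    · exfalso
      have hsub : arc (D \ τ) ⊆ arc τ := by
        rw [harc, heq]
        intro v _
        by_cases hv : v ≤ D.max' hD
        · exact Or.inl hv
        · exact Or.inr (lt_of_not_ge hv)
      have := wtA_nonneg_of_superset (D := D) (A := A) hU hV hsub
      omega
  have h0f : D.min' hD < f :=
    lt_of_le_of_ne (D.min'_le f (hτ hfτ)) fun heq => h0 (heq ▸ hfτ)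
  have hl1 : l < D.max' hD :=
    lt_of_le_of_ne (D.le_max' l (mem_sdiff.1 hlD).1) fun heq => hlτ (heq ▸ h1)
  have hW1 : arc τ ⊆ {v | v ≤ f ∨ l < v} := by
    rw [harc]
    rintro v (hv | hv)
    · exact Or.inl hv
    · exact Or.inr (lt_trans hl1 hv)
  have hW2 : arc (D \ τ) ⊆ {v | v ≤ f ∨ l < v} := by
    rw [harc']
    rintro v (hv | hv)
    · exact Or.inl (le_trans hv h0f.le)
    · exact Or.inr hv
  refine ⟨hhf, h0f, hf1, hl1, ?_, ?_⟩
  · rcases hc with ⟨hU1, -, -, -⟩ | ⟨-, hU2, -, -⟩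
    · exact hU hW1 hU1
    · exact hU hW2 hU2
  · rcases hc with ⟨-, -, -, hV2⟩ | ⟨-, -, hV1, -⟩
    · exact hV hW2 hV2
    · exact hV hW1 hV1

end Negatives

end TCycle

end Summit.Ventures.PercRepro2
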